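import Summits.QuantumFields.YangMills.Theorems.BalabanUVNodesC44IterMhOneStepLoops
import HarnessLib

/-!
# (ℓa-C) ROAD B, FILE F4′-3b — ONE AVERAGING STEP, PART 2: THE THREE FACTORS — the background correction `E = corrM W c = e^{m₀}` (unitary, `‖E − 1‖ ≤ 12ε`), the
# block gauge factor `H = eml{D(Γ)}` (`det H = 1`, `H = 1 + Φ + O(φ²)`), and the complex correction `corrMh Ṽ c` (`det = 1`, near `1`)

Cell `pub-ymgap` ∕ `ym-nodeO-ideate`, porter lineage `ymgap-nodeO-port-PTB-1` (gen 7), hand «(44) for `iterMh`» (director-ym g22 №569/№571; PORT-PLAN-v5 dc7ff9950b0ac185,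
§ F4′-3).  `--kind proof --supports stmt-QuantumFields-27238 --as helper`; count-neutral.  [B7] = [Balaban1985Averaging]; [B11] = [Balaban1985Variational]; [I] = [Balaban1987RG1].

WHAT IS PROVED (0 def, 0 sorry, axioms standard; ns `Summit.QuantumFields.YangMills.Theorems.C44IterMh`).
* §1 the background correction factor: `corrM_eq_exp_meanLog`, `norm_meanLog_le` (`‖m₀‖ ≤ 2ε`), `corrM_mem_unitaryGroup'` ((0.9), ✓`eml_mem_unitaryGroup`), `norm_corrM_sub_one_le` (`≤ 12ε`,
  ✓`norm_eml_add_sub_eml_le`), `star_corrM_eq_exp_neg` (`E⋆ = e^{−m₀}`), `mlog_corrM_eq` (`log E = m₀`).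
* §2 the block gauge factor: ★ `blockH_det_eq_one` (✓`det_eml_eq_one`), `norm_blockH_sub_one_sub_mean_le` (`36φ²`, ✓`norm_eml_one_add_sub_sub_mean_le`), `norm_blockH_sub_one_le` (`2φ`),
  `norm_blockH_inv_sub_one_add_mean_le` (`‖H⁻¹ − 1 + Φ‖ ≤ 44φ²`, `‖H⁻¹ − 1‖ ≤ 4φ`).
* §3 the complex correction factor: `norm_corrMh_sub_one_le` (`≤ 12(7(φ+λ)+ε)`), `det_corrMh_eq_one`, `det_avgMh_eq_one_SL`.

HONEST FRAMING.  Elementary consequences of lit's PROVED analytic-mean theorems over DEFINED objects; nothing of [B7] Props 1–3∕7 or [B11] (44) is asserted beyond what is proved.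
(ℓa-C)(ℓa-H)(ℓd) DISPLAYED; (R1)∕(R2) OPEN; K0ᴬ ⟨stmt-QuantumFields-27238⟩ NOT closed; K0ᴬ∕K1ᴬ∕K3ᴬ 0∕3; NODE O 0∕1; COUNT 8∕28 · K 1∕4 UNMOVED; finite `𝕋⁴_{L^K}` at fixed ε — NOT
continuum ∕ ℝ⁴ ∕ OS; **the Yang–Mills mass gap (Clay) is NOT proved by any of this.**  No `sorry`, `instance`, `notation`, `set_option`; standard axioms.
-/

noncomputable section

open scoped Matrix Matrix.Norms.L2Operator

namespace Summit.QuantumFields.YangMills.Theorems.C44IterMh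

open Literature.MathematicalPhysics.QuantumFieldTheory.Balaban1983to89
open Literature.MathematicalPhysics.QuantumFieldTheory.Balaban1983to89.Node00
open T4Continuum BlockAveraging
open B15AveragingHolomorphic (stepMh holMh holMh_nil holMh_cons loopMh corrMh axialMh avgMh avgMh_coeField loopMh_coeField)
open B7TransferAnalyticMean (meanCLM meanCLM_apply norm_meanCLM_apply_le norm_exp_sub_one_le_two_mul norm_exp_sub_one_sub_self_le)
open BlockAveragingEMLAnalyticMean (isAnalyticMean_eml eml_eq_exp_meanCLM eml_one norm_eml_add_sub_eml_le norm_eml_one_add_sub_sub_mean_le)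
open MatrixLog (mlog exp_mlog norm_mlog_le_two_mul)
open ExpMeanLog (eml)
open NormedSpace (exp)

variable {P : Params} {j : ℕ} {N : ℕ} [NeZero N]

/-! ## §1  The background correction factor `E = corrM W c = e^{m₀}`, `m₀ = mean log ω` -/

omit [NeZero N] in
/-- `corrM W c = exp(mean_i log ω_i)` (the printed `exp[mean log]`, b07's `meanCLM`). [cite: Balaban1987RG1, (0.4) p.253] -/
theorem corrM_eq_exp_meanLog (W : GaugeField P j (SU N)) (c : PBond P (j + 1)) :
    corrM (coeField W) c = exp (meanCLM (Idx P) (Matrix (Fin N) (Fin N) ℂ) fun i => mlog (loopM (coeField W) c i)) :=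
  eml_eq_exp_meanCLM _

omit [NeZero N] in
/-- `‖m₀‖ ≤ 2ε` (the mean does not increase sup norms; (26) `‖log ω‖ ≤ 2‖ω − 1‖`). [cite: Balaban1985Averaging, (26) p.22; Balaban1987RG1, (0.4) p.253] -/
theorem norm_meanLog_le (W : GaugeField P j (SU N)) {ε : ℝ} (hε : ∀ c i, ‖loopM (coeField W) c i - 1‖ ≤ ε) (hε2 : ε ≤ 1 / 2) (c : PBond P (j + 1)) :
    ‖meanCLM (Idx P) (Matrix (Fin N) (Fin N) ℂ) (fun i => mlog (loopM (coeField W) c i))‖ ≤ 2 * ε := by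
  have hε0 : 0 ≤ ε := (norm_nonneg _).trans (hε c (Classical.arbitrary _))
  refine (norm_meanCLM_apply_le _).trans ((pi_norm_le_iff_of_nonneg (by linarith)).2 fun i => ?_)
  exact (norm_mlog_le_two_mul ((hε c i).trans hε2)).trans (by linarith [hε c i])

/-- `E = corrM W c` is unitary ((0.9) for the printed operation, ✓`eml_mem_unitaryGroup`). [cite: Balaban1987RG1, (0.9) p.253] -/
theorem corrM_mem_unitaryGroup' (W : GaugeField P j (SU N)) {ε : ℝ} (hε : ∀ c i, ‖loopM (coeField W) c i - 1‖ ≤ ε) (hε3 : ε ≤ 1 / 3) (c : PBond P (j + 1)) :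
    corrM (coeField W) c ∈ Matrix.unitaryGroup (Fin N) ℂ :=
  ExpMeanLog.eml_mem_unitaryGroup (fun i => loopM_coeField_mem_unitaryGroup W c i) fun i => (hε c i).trans hε3

omit [NeZero N] in
/-- `‖E − 1‖ ≤ 12ε` («the average is close to the identity also», ✓`norm_eml_add_sub_eml_le` at the identity tuple). [cite: Balaban1987RG1, (0.8) p.253] -/
theorem norm_corrM_sub_one_le (W : GaugeField P j (SU N)) {ε : ℝ} (hε : ∀ c i, ‖loopM (coeField W) c i - 1‖ ≤ ε) (hε24 : ε ≤ 1 / 24) (c : PBond P (j + 1)) :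
    ‖corrM (coeField W) c - 1‖ ≤ 12 * ε := by
  have hε0 : 0 ≤ ε := (norm_nonneg _).trans (hε c (Classical.arbitrary _))
  have hV : ‖(fun i => loopM (coeField W) c i) - 1‖ ≤ ε := (pi_norm_le_iff_of_nonneg hε0).2 fun i => by simpa using hε c i
  have h := norm_eml_add_sub_eml_le (U := (1 : Idx P → Matrix (Fin N) (Fin N) ℂ)) (V := (fun i => loopM (coeField W) c i) - 1)
    (by rw [sub_self, norm_zero]; norm_num) (hV.trans hε24)
  rw [add_sub_cancel, eml_one] at h
  exact h.trans (by linarith)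

/-- `E⋆ = e^{−m₀}` (`E` unitary, `E = e^{m₀}`: both are the inverse of `E`). [cite: Balaban1987RG1, (0.5) p.253, (0.9) p.253] -/
theorem star_corrM_eq_exp_neg (W : GaugeField P j (SU N)) {ε : ℝ} (hε : ∀ c i, ‖loopM (coeField W) c i - 1‖ ≤ ε) (hε3 : ε ≤ 1 / 3) (c : PBond P (j + 1)) :
    star (corrM (coeField W) c) = exp (-(meanCLM (Idx P) (Matrix (Fin N) (Fin N) ℂ) fun i => mlog (loopM (coeField W) c i))) := by
  have h1 : (corrM (coeField W) c)⁻¹ = star (corrM (coeField W) c) := Matrix.inv_eq_left_inv (Unitary.star_mul_self_of_mem (corrM_mem_unitaryGroup' W hε hε3 c))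
  have h2 : (corrM (coeField W) c)⁻¹ = exp (-(meanCLM (Idx P) (Matrix (Fin N) (Fin N) ℂ) fun i => mlog (loopM (coeField W) c i))) := by
    refine Matrix.inv_eq_left_inv ?_
    letI : NormedAlgebra ℚ (Matrix (Fin N) (Fin N) ℂ) := NormedAlgebra.restrictScalars ℚ ℂ _
    rw [corrM_eq_exp_meanLog, ← NormedSpace.exp_add_of_commute (Commute.refl _).neg_left, neg_add_cancel, NormedSpace.exp_zero]
  rw [← h1, h2]

omit [NeZero N] in
/-- `log E = m₀` (`‖m₀‖ ≤ 2ε < ln 2`, `log ∘ exp = id` there). [cite: Balaban1985Averaging, (23) p.21; Balaban1987RG1, (0.4) p.253] -/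
theorem mlog_corrM_eq (W : GaugeField P j (SU N)) {ε : ℝ} (hε : ∀ c i, ‖loopM (coeField W) c i - 1‖ ≤ ε) (hε4 : ε ≤ 1 / 4) (c : PBond P (j + 1)) :
    mlog (corrM (coeField W) c) = meanCLM (Idx P) (Matrix (Fin N) (Fin N) ℂ) (fun i => mlog (loopM (coeField W) c i)) := by
  rw [corrM_eq_exp_meanLog]
  refine B7BlockAvgLog.mlog_exp ((norm_meanLog_le W hε (by linarith) c).trans_lt ?_)
  have := Real.log_two_gt_d9
  linarith

/-! ## §2  The block gauge factor `H = eml{D(Γ_i)}` -/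

omit [NeZero N] in
/-- ★ **`det H = 1`** — the block gauge factor is `SL(N,ℂ)`-valued (✓`det_eml_eq_one`; `det D(Γ) = 1`, `‖D(Γ) − 1‖ ≤ φ ≤ 1∕3`, `Nφ < π`). [cite: Balaban1987RG1, before (0.5) p.253 («Gᶜ-valued»)] -/
theorem blockH_det_eq_one {F : Idx P → Matrix (Fin N) (Fin N) ℂ} (hdetF : ∀ i, (F i).det = 1) {φ : ℝ} (hF : ∀ i, ‖F i - 1‖ ≤ φ) (hφ3 : φ ≤ 1 / 3)
    (hNφ : (N : ℝ) * φ < Real.pi) : (eml F).det = 1 :=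
  ExpMeanLog.det_eml_eq_one hdetF (fun i => (hF i).trans hφ3) fun i => by
    rw [Fintype.card_fin]
    exact lt_of_le_of_lt (mul_le_mul_of_nonneg_left (hF i) (Nat.cast_nonneg _)) hNφ

omit [NeZero N] in
/-- `H = 1 + mean(D − 1) + O(φ²)`: `‖H − 1 − Φ‖ ≤ 36φ²` (✓`norm_eml_one_add_sub_sub_mean_le`). [cite: Balaban1987RG1, (0.8) p.253] -/
theorem norm_blockH_sub_one_sub_mean_le {F : Idx P → Matrix (Fin N) (Fin N) ℂ} {φ : ℝ} (hF : ∀ i, ‖F i - 1‖ ≤ φ) (hφ12 : φ ≤ 1 / 12) :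
    ‖eml F - 1 - meanCLM (Idx P) (Matrix (Fin N) (Fin N) ℂ) (fun i => F i - 1)‖ ≤ 36 * φ ^ 2 := by
  have hφ0 : 0 ≤ φ := (norm_nonneg _).trans (hF (Classical.arbitrary _))
  have hV : ‖(fun i => F i - 1)‖ ≤ φ := (pi_norm_le_iff_of_nonneg hφ0).2 hF
  have h := norm_eml_one_add_sub_sub_mean_le (V := fun i => F i - 1) (hV.trans hφ12)
  have h1 : (1 : Idx P → Matrix (Fin N) (Fin N) ℂ) + (fun i => F i - 1) = F := funext fun i => by simp
  rw [h1] at h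
  exact h.trans (by nlinarith [mul_le_mul hV hV (norm_nonneg _) hφ0])

omit [NeZero N] in
/-- `‖H − 1‖ ≤ 2φ` (`φ ≤ 1∕36`). [cite: Balaban1987RG1, (0.8) p.253] -/
theorem norm_blockH_sub_one_le {F : Idx P → Matrix (Fin N) (Fin N) ℂ} {φ : ℝ} (hF : ∀ i, ‖F i - 1‖ ≤ φ) (hφ36 : φ ≤ 1 / 36) : ‖eml F - 1‖ ≤ 2 * φ := by
  have hφ0 : 0 ≤ φ := (norm_nonneg _).trans (hF (Classical.arbitrary _))
  have h := norm_blockH_sub_one_sub_mean_le hF (by linarith)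
  have hΦ : ‖meanCLM (Idx P) (Matrix (Fin N) (Fin N) ℂ) (fun i => F i - 1)‖ ≤ φ := (norm_meanCLM_apply_le _).trans ((pi_norm_le_iff_of_nonneg hφ0).2 hF)
  have htri := norm_le_insert' (eml F - 1) (meanCLM (Idx P) (Matrix (Fin N) (Fin N) ℂ) (fun i => F i - 1))
  nlinarith

/-- `‖H⁻¹ − 1 + Φ‖ ≤ 44φ²` (the inverse to first order, F4′-2a, + `H − 1 − Φ = O(φ²)`); also `‖H⁻¹ − 1‖ ≤ 4φ`. [cite: Balaban1987RG1, (0.5) p.253, (0.8) p.253] -/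
theorem norm_blockH_inv_sub_one_add_mean_le {F : Idx P → Matrix (Fin N) (Fin N) ℂ} (hdetF : ∀ i, (F i).det = 1) {φ : ℝ} (hF : ∀ i, ‖F i - 1‖ ≤ φ) (hφ36 : φ ≤ 1 / 36)
    (hNφ : (N : ℝ) * φ < Real.pi) :
    ‖(eml F)⁻¹ - 1 + meanCLM (Idx P) (Matrix (Fin N) (Fin N) ℂ) (fun i => F i - 1)‖ ≤ 44 * φ ^ 2 ∧ ‖(eml F)⁻¹ - 1‖ ≤ 4 * φ := by
  have hφ0 : 0 ≤ φ := (norm_nonneg _).trans (hF (Classical.arbitrary _))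
  have hdet := sl_isUnit_det (blockH_det_eq_one hdetF hF (by linarith) hNφ)
  have hH := norm_blockH_sub_one_le hF hφ36
  have h1 := norm_inv_sub_one_add_le_of_det hdet hH (by linarith)
  have h2 := norm_blockH_sub_one_sub_mean_le hF (by linarith)
  refine ⟨?_, norm_inv_sub_one_le_of_det hdet hH (by linarith) |>.trans (by linarith)⟩
  have hsplit : (eml F)⁻¹ - 1 + meanCLM (Idx P) (Matrix (Fin N) (Fin N) ℂ) (fun i => F i - 1)
      = ((eml F)⁻¹ - 1 + (eml F - 1)) - (eml F - 1 - meanCLM (Idx P) (Matrix (Fin N) (Fin N) ℂ) (fun i => F i - 1)) := by abel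
  rw [hsplit]
  refine (norm_sub_le _ _).trans ?_
  nlinarith

/-! ## §3  The complex correction factor `corrMh Ṽ c = eml{D_iω_i}` -/

/-- `‖corrMh Ṽ c − 1‖ ≤ 12(7(φ+λ) + ε)` (the loops of `Ṽ` are within `7(φ+λ)+ε ≤ 1∕24` of `1`). [cite: Balaban1987RG1, (0.8) p.253] -/
theorem norm_corrMh_sub_one_le (W : GaugeField P j (SU N)) {V : PBond P j → Matrix (Fin N) (Fin N) ℂ} (hdet : ∀ b, (V b).det = 1) {s φ lam ε : ℝ}
    (hs : ∀ b, ‖V b * star (W b : Matrix (Fin N) (Fin N) ℂ) - 1‖ ≤ s) (hs2 : s ≤ 1 / 2) (hφ : (1 + 2 * s) ^ (P.d * P.L) - 1 ≤ φ) (hlam : (1 + 2 * s) ^ P.L - 1 ≤ lam)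
    (hφ2 : φ ≤ 1 / 2) (hlam2 : lam ≤ 1 / 2) (hσ : 3 * φ + 3 * lam ≤ 1) (hε : ∀ c i, ‖loopM (coeField W) c i - 1‖ ≤ ε) (hε6 : ε ≤ 1 / 6)
    (h24 : 7 * (φ + lam) + ε ≤ 1 / 24) (c : PBond P (j + 1)) :
    ‖corrMh V c - 1‖ ≤ 12 * (7 * (φ + lam) + ε) := by
  have hl := norm_loopMh_sub_one_le W hdet hs hs2 hφ hlam hφ2 hlam2 hσ hε hε6 c
  have h0 : 0 ≤ 7 * (φ + lam) + ε := (norm_nonneg _).trans (hl (Classical.arbitrary _))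
  have hV : ‖(fun i => loopMh V c i) - 1‖ ≤ 7 * (φ + lam) + ε := (pi_norm_le_iff_of_nonneg h0).2 fun i => by simpa using hl i
  have h := norm_eml_add_sub_eml_le (U := (1 : Idx P → Matrix (Fin N) (Fin N) ℂ)) (V := (fun i => loopMh V c i) - 1)
    (by rw [sub_self, norm_zero]; norm_num) (hV.trans h24)
  rw [add_sub_cancel, eml_one] at h
  exact h.trans (by linarith)

/-- `det corrMh Ṽ c = 1` (✓`det_eml_eq_one` at the loop family of `Ṽ`: determinant one, within `1∕3`, `N·(…) < π`). [cite: Balaban1987RG1, before (0.5) p.253 («Gᶜ-valued»)] -/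
theorem det_corrMh_eq_one (W : GaugeField P j (SU N)) {V : PBond P j → Matrix (Fin N) (Fin N) ℂ} (hdet : ∀ b, (V b).det = 1) {s φ lam ε : ℝ}
    (hs : ∀ b, ‖V b * star (W b : Matrix (Fin N) (Fin N) ℂ) - 1‖ ≤ s) (hs2 : s ≤ 1 / 2) (hφ : (1 + 2 * s) ^ (P.d * P.L) - 1 ≤ φ) (hlam : (1 + 2 * s) ^ P.L - 1 ≤ lam)
    (hφ2 : φ ≤ 1 / 2) (hlam2 : lam ≤ 1 / 2) (hσ : 3 * φ + 3 * lam ≤ 1) (hε : ∀ c i, ‖loopM (coeField W) c i - 1‖ ≤ ε) (hε6 : ε ≤ 1 / 6)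
    (h3 : 7 * (φ + lam) + ε ≤ 1 / 3) (hN : (N : ℝ) * (7 * (φ + lam) + ε) < Real.pi) (c : PBond P (j + 1)) :
    (corrMh V c).det = 1 := by
  have hl := norm_loopMh_sub_one_le W hdet hs hs2 hφ hlam hφ2 hlam2 hσ hε hε6 c
  refine ExpMeanLog.det_eml_eq_one (fun i => det_loopMh_eq_one' hdet c i) (fun i => (hl i).trans h3) fun i => ?_
  rw [Fintype.card_fin]
  exact lt_of_le_of_lt (mul_le_mul_of_nonneg_left (hl i) (Nat.cast_nonneg _)) hN

/-- `det Ū_h(Ṽ)(c) = 1`. [cite: Balaban1985Variational, p.307 («Gᶜ-valued fields»); Balaban1987RG1, (0.4) p.253] -/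
theorem det_avgMh_eq_one_SL (W : GaugeField P j (SU N)) {V : PBond P j → Matrix (Fin N) (Fin N) ℂ} (hdet : ∀ b, (V b).det = 1) {s φ lam ε : ℝ}
    (hs : ∀ b, ‖V b * star (W b : Matrix (Fin N) (Fin N) ℂ) - 1‖ ≤ s) (hs2 : s ≤ 1 / 2) (hφ : (1 + 2 * s) ^ (P.d * P.L) - 1 ≤ φ) (hlam : (1 + 2 * s) ^ P.L - 1 ≤ lam)
    (hφ2 : φ ≤ 1 / 2) (hlam2 : lam ≤ 1 / 2) (hσ : 3 * φ + 3 * lam ≤ 1) (hε : ∀ c i, ‖loopM (coeField W) c i - 1‖ ≤ ε) (hε6 : ε ≤ 1 / 6)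
    (h3 : 7 * (φ + lam) + ε ≤ 1 / 3) (hN : (N : ℝ) * (7 * (φ + lam) + ε) < Real.pi) (c : PBond P (j + 1)) :
    (avgMh V c).det = 1 := by
  show (corrMh V c * axialMh V c).det = 1
  rw [Matrix.det_mul, det_corrMh_eq_one W hdet hs hs2 hφ hlam hφ2 hlam2 hσ hε hε6 h3 hN c]
  unfold axialMh
  rw [det_holMh_eq_one_SL hdet, one_mul]

end Summit.QuantumFields.YangMills.Theorems.C44IterMh

end
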